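import Literature.Geometry.Riemannian.GaussianAreaLocalDensity
import HarnessLib

/-!
# Gaussian areas pass to the limit: local convergence plus uniform Gaussian bounds

Topic `Literature/Geometry/Riemannian`.  An abstract convergence principle for the Colding–Minicozzi
Gaussian areas `F_{p,t}(S) = gaussianArea n p t S` (`ColdingMinicozziEntropy.lean`) of a sequence
of measurable sets `Sₖ → S`: if the weighted Hausdorff integrals converge LOCALLY — on each of a
sequence of regions `Aⱼ ⊇ B(p, Rⱼ)`, `Rⱼ → ∞` —

  `∫_{Sₖ ∩ Aⱼ} e^{-‖x-p‖²/4t} dμHE[n] → ∫_{S ∩ Aⱼ} e^{-‖x-p‖²/4t} dμHE[n]`  (`k → ∞`, each `j`),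

and the Gaussian areas at the doubled scale are uniformly bounded, `F_{p,2t}(Sₖ), F_{p,2t}(S) ≤ Λ`
with `Λ < ∞` (uniform tails, `gaussianArea_diff_ball_le`), then `F_{p,t}(Sₖ) → F_{p,t}(S)`
(`tendsto_gaussianArea_of_local`; `tendsto_gaussianArea_of_local_cutoff` is the same
with measurable cutoffs `ψⱼ ≤ 1`, `ψⱼ = 1` on `B(p, Rⱼ)`, in place of the regions).  With the
area formula
(`Geometry/GeometricMeasureTheory/AreaFormulaLimits.lean`) supplying the local convergence on graph
patches, this is how the Gaussian density bound `Θ ≤ 1 + ε` of a sequence of flows survives in a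
locally smoothly converging blow-up limit (White 2005, proof of Thm. 3.1, (6) on p. 1498).

Everything is PROVED; no definitions, no named facts.

## References

* B. White, *A local regularity theorem for mean curvature flow*, Ann. of Math. 161 (2005),
  proof of Thm. 3.1, p. 1498. [White2005]
* T. H. Colding, W. P. Minicozzi II, Ann. of Math. 175 (2012), §1 (the `F`-functionals).
  [ColdingMinicozzi2012]
-/

noncomputable section

namespace Literature.Geometry.Riemannian

open Set Function Filter Module Metric
open _root_.MeasureTheory _root_.MeasureTheory.Measure
open scoped ENNReal NNReal Topology

variable {F : Type*} [NormedAddCommGroup F] [MeasurableSpace F] [BorelSpace F]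

/-- Splitting a Gaussian area along a measurable region: `F(S) ≤ F(S ∩ A) + F(S ∖ A)` and
`F(S ∩ A) ≤ F(S)`. [folklore] -/
theorem gaussianArea_le_inter_add_diff (n : ℕ) (p : F) (t : ℝ) (S A : Set F) :
    gaussianArea n p t S ≤ gaussianArea n p t (S ∩ A) + gaussianArea n p t (S \ A) := by
  have hsplit : S = (S ∩ A) ∪ (S \ A) := by
    ext y
    constructor
    · intro hy
      by_cases hyA : y ∈ A
      exacts [Or.inl ⟨hy, hyA⟩, Or.inr ⟨hy, hyA⟩]
    · rintro (⟨hy, -⟩ | ⟨hy, -⟩) <;> exact hy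
  calc gaussianArea n p t S = gaussianArea n p t ((S ∩ A) ∪ (S \ A)) := by rw [← hsplit]
    _ ≤ _ := gaussianArea_union_le _ _ _ _ _

/-- The far part beyond a region containing `B(p, R)`, under a Gaussian bound at scale `2t`:
`F_{p,t}(S ∖ A) ≤ 2^{n/2} e^{-R²/8t} Λ`. [folklore] -/
theorem gaussianArea_diff_le_errFactor_mul (n : ℕ) (p : F) {t : ℝ} (ht : 0 < t) {S A : Set F}
    (hS : MeasurableSet S) {R : ℝ} (hR : 0 ≤ R) (hA : ball p R ⊆ A) {Λ : ℝ≥0∞}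
    (hΛ : gaussianArea n p (2 * t) S ≤ Λ) :
    gaussianArea n p t (S \ A) ≤
      ENNReal.ofReal ((2 : ℝ) ^ ((n : ℝ) / 2) * Real.exp (-R ^ 2 / (8 * t))) * Λ :=
  calc gaussianArea n p t (S \ A) ≤ gaussianArea n p t (S \ ball p R) :=
        gaussianArea_mono _ _ _ fun _ hy => ⟨hy.1, fun h => hy.2 (hA h)⟩
    _ ≤ ENNReal.ofReal ((2 : ℝ) ^ ((n : ℝ) / 2) * Real.exp (-R ^ 2 / (8 * t))) *
          gaussianArea n p (2 * t) S := gaussianArea_diff_ball_le n p ht hS hR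
    _ ≤ _ := mul_le_mul' le_rfl hΛ

/-- The far-part factor along radii `Rⱼ → ∞` tends to `0` (fixed `t > 0`). [folklore] -/
theorem tendsto_errFactor_atTop (n : ℕ) {t : ℝ} (ht : 0 < t) {R : ℕ → ℝ}
    (hR : Tendsto R atTop atTop) :
    Tendsto (fun j => ENNReal.ofReal ((2 : ℝ) ^ ((n : ℝ) / 2) * Real.exp (-R j ^ 2 / (8 * t))))
      atTop (𝓝 0) := by
  have h1 : Tendsto (fun j => R j ^ 2 / (8 * t)) atTop atTop := by
    have h2 : Tendsto (fun j => R j ^ 2) atTop atTop := (tendsto_pow_atTop two_ne_zero).comp hR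
    exact h2.atTop_div_const (by positivity)
  have h3 : Tendsto (fun j => Real.exp (-(R j ^ 2 / (8 * t)))) atTop (𝓝 0) :=
    Real.tendsto_exp_neg_atTop_nhds_zero.comp h1
  have h4 : Tendsto (fun j => (2 : ℝ) ^ ((n : ℝ) / 2) * Real.exp (-(R j ^ 2 / (8 * t)))) atTop
      (𝓝 0) := by simpa using h3.const_mul ((2 : ℝ) ^ ((n : ℝ) / 2))
  have h5 := ENNReal.tendsto_ofReal h4
  rw [ENNReal.ofReal_zero] at h5
  refine h5.congr fun j => ?_
  rw [neg_div]

/-- **Gaussian areas pass to the limit from local convergence and uniform Gaussian bounds.**  Let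
`Sₖ, S ⊆ F` be measurable, `t > 0`, `Aⱼ` regions with `B(p, Rⱼ) ⊆ Aⱼ`, `Rⱼ → ∞`.
If `∫_{Sₖ ∩ Aⱼ} e^{-‖x-p‖²/4t} dμHE[n] → ∫_{S ∩ Aⱼ} e^{-‖x-p‖²/4t} dμHE[n]` as `k → ∞` for every
`j`,
and `F_{p,2t}(Sₖ) ≤ Λ`, `F_{p,2t}(S) ≤ Λ` with `Λ < ∞`, then `F_{p,t}(Sₖ) → F_{p,t}(S)`.
[cite: White2005, proof of Thm. 3.1, p. 1498] -/
theorem tendsto_gaussianArea_of_local (n : ℕ) (p : F) {t : ℝ} (ht : 0 < t)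
    {Ss : ℕ → Set F} {S : Set F} (hSs : ∀ k, MeasurableSet (Ss k)) (hS : MeasurableSet S)
    {A : ℕ → Set F} {R : ℕ → ℝ} (hR0 : ∀ j, 0 ≤ R j)
    (hR : Tendsto R atTop atTop) (hA : ∀ j, ball p (R j) ⊆ A j)
    (hloc : ∀ j, Tendsto (fun k => ∫⁻ x in Ss k ∩ A j, gaussianWeight p t x ∂(μHE[n] : Measure F))
      atTop (𝓝 (∫⁻ x in S ∩ A j, gaussianWeight p t x ∂(μHE[n] : Measure F))))
    {Λ : ℝ≥0∞} (hΛ : Λ ≠ ∞) (hbds : ∀ k, gaussianArea n p (2 * t) (Ss k) ≤ Λ)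
    (hbd : gaussianArea n p (2 * t) S ≤ Λ) :
    Tendsto (fun k => gaussianArea n p t (Ss k)) atTop (𝓝 (gaussianArea n p t S)) := by
  -- the error terms `δ j = 2^{n/2} e^{-Rⱼ²/8t} Λ → 0`
  set δ : ℕ → ℝ≥0∞ := fun j =>
    ENNReal.ofReal ((2 : ℝ) ^ ((n : ℝ) / 2) * Real.exp (-R j ^ 2 / (8 * t))) * Λ with hδ
  have hδlim : Tendsto δ atTop (𝓝 0) := by
    have h := ENNReal.Tendsto.mul_const (tendsto_errFactor_atTop n ht hR) (Or.inr hΛ)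
    rwa [zero_mul] at h
  -- local Gaussian areas converge
  have hlocG : ∀ j, Tendsto (fun k => gaussianArea n p t (Ss k ∩ A j)) atTop
      (𝓝 (gaussianArea n p t (S ∩ A j))) := fun j => by
    simp only [gaussianArea_eq]
    exact ENNReal.Tendsto.const_mul (hloc j) (Or.inr (gaussianNormalization_ne_top n t))
  have hbδ : ∀ b : ℝ≥0∞, Tendsto (fun j => b + δ j) atTop (𝓝 b) := fun b => by
    simpa using (tendsto_const_nhds (x := b)).add hδlim
  refine tendsto_of_le_liminf_of_limsup_le ?_ ?_
  · -- `F(S) ≤ liminf F(Sₖ)`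
    refine ge_of_tendsto' (hbδ _) fun j => ?_
    calc gaussianArea n p t S ≤ gaussianArea n p t (S ∩ A j) + gaussianArea n p t (S \ A j) :=
          gaussianArea_le_inter_add_diff n p t S (A j)
      _ ≤ gaussianArea n p t (S ∩ A j) + δ j :=
          add_le_add le_rfl (gaussianArea_diff_le_errFactor_mul n p ht hS (hR0 j) (hA j) hbd)
      _ = liminf (fun k => gaussianArea n p t (Ss k ∩ A j)) atTop + δ j := by
          rw [(hlocG j).liminf_eq]
      _ ≤ liminf (fun k => gaussianArea n p t (Ss k)) atTop + δ j :=
          add_le_add (liminf_le_liminf (Eventually.of_forall fun k =>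
            gaussianArea_mono _ _ _ inter_subset_left)) le_rfl
  · -- `limsup F(Sₖ) ≤ F(S)`
    refine ge_of_tendsto' (hbδ _) fun j => ?_
    calc limsup (fun k => gaussianArea n p t (Ss k)) atTop
        ≤ limsup (fun k => gaussianArea n p t (Ss k ∩ A j) + δ j) atTop :=
          limsup_le_limsup (Eventually.of_forall fun k =>
            (gaussianArea_le_inter_add_diff n p t (Ss k) (A j)).trans
              (add_le_add le_rfl (gaussianArea_diff_le_errFactor_mul n p ht (hSs k) (hR0 j)
                (hA j) (hbds k))))
      _ = gaussianArea n p t (S ∩ A j) + δ j :=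
          ((hlocG j).add tendsto_const_nhds).limsup_eq
      _ ≤ gaussianArea n p t S + δ j :=
          add_le_add (gaussianArea_mono _ _ _ inter_subset_left) le_rfl

/-! ### The same with continuous cutoffs instead of regions

For the application the local convergence comes from vague convergence of the area measures
(test functions assembled from graph patches by a partition of unity), so the regions `Aⱼ` are
replaced by measurable cutoffs `ψⱼ : F → [0, ∞]`, `ψⱼ ≤ 1`, `ψⱼ = 1` on `B(p, Rⱼ)`. -/

/-- Splitting along a cutoff which is `1` on `B(p, R)`:
`∫_S w ≤ ∫_S w ψ + ∫_{S ∖ B(p,R)} w`. [folklore] -/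
theorem setLIntegral_gaussianWeight_le_cutoff_add (n : ℕ) (p : F) (t : ℝ) (S : Set F)
    {ψ : F → ℝ≥0∞} {R : ℝ} (hψ1 : ∀ x ∈ ball p R, ψ x = 1) :
    ∫⁻ x in S, gaussianWeight p t x ∂(μHE[n] : Measure F) ≤
      ∫⁻ x in S, gaussianWeight p t x * ψ x ∂(μHE[n] : Measure F) +
        ∫⁻ x in S \ ball p R, gaussianWeight p t x ∂(μHE[n] : Measure F) := by
  have hpt : ∀ x, gaussianWeight p t x ≤
      gaussianWeight p t x * ψ x + (ball p R)ᶜ.indicator (gaussianWeight p t) x := by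
    intro x
    by_cases hx : x ∈ ball p R
    · rw [hψ1 x hx, mul_one]
      exact le_self_add
    · rw [indicator_of_mem (mem_compl hx)]
      exact le_add_self
  calc ∫⁻ x in S, gaussianWeight p t x ∂(μHE[n] : Measure F)
      ≤ ∫⁻ x in S, gaussianWeight p t x * ψ x + (ball p R)ᶜ.indicator (gaussianWeight p t) x
          ∂(μHE[n] : Measure F) := lintegral_mono fun x => hpt x
    _ = ∫⁻ x in S, gaussianWeight p t x * ψ x ∂(μHE[n] : Measure F) +
          ∫⁻ x in S, (ball p R)ᶜ.indicator (gaussianWeight p t) x ∂(μHE[n] : Measure F) :=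
        lintegral_add_right' _ ((measurable_gaussianWeight p t).indicator
          measurableSet_ball.compl).aemeasurable
    _ = ∫⁻ x in S, gaussianWeight p t x * ψ x ∂(μHE[n] : Measure F) +
          ∫⁻ x in S \ ball p R, gaussianWeight p t x ∂(μHE[n] : Measure F) := by
        congr 1
        rw [lintegral_indicator measurableSet_ball.compl, Measure.restrict_restrict
          measurableSet_ball.compl, inter_comm]
        rfl

/-- **Gaussian areas pass to the limit from local convergence against cutoffs and uniform
Gaussian bounds** (variant of `tendsto_gaussianArea_of_local`): with measurable cutoffs
`ψⱼ ≤ 1`, `ψⱼ = 1` on `B(p, Rⱼ)`, `Rⱼ → ∞`, local convergence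
`∫_{Sₖ} e^{-‖x-p‖²/4t} ψⱼ dμHE[n] → ∫_S e^{-‖x-p‖²/4t} ψⱼ dμHE[n]` for every `j` and the bounds
`F_{p,2t}(Sₖ), F_{p,2t}(S) ≤ Λ < ∞` give `F_{p,t}(Sₖ) → F_{p,t}(S)`.
[cite: White2005, proof of Thm. 3.1, p. 1498] -/
theorem tendsto_gaussianArea_of_local_cutoff (n : ℕ) (p : F) {t : ℝ} (ht : 0 < t)
    {Ss : ℕ → Set F} {S : Set F} (hSs : ∀ k, MeasurableSet (Ss k)) (hS : MeasurableSet S)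
    {ψ : ℕ → F → ℝ≥0∞} (hψ1 : ∀ j x, ψ j x ≤ 1) {R : ℕ → ℝ} (hR0 : ∀ j, 0 ≤ R j)
    (hR : Tendsto R atTop atTop) (hψR : ∀ j, ∀ x ∈ ball p (R j), ψ j x = 1)
    (hloc : ∀ j, Tendsto
      (fun k => ∫⁻ x in Ss k, gaussianWeight p t x * ψ j x ∂(μHE[n] : Measure F)) atTop
      (𝓝 (∫⁻ x in S, gaussianWeight p t x * ψ j x ∂(μHE[n] : Measure F))))
    {Λ : ℝ≥0∞} (hΛ : Λ ≠ ∞) (hbds : ∀ k, gaussianArea n p (2 * t) (Ss k) ≤ Λ)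
    (hbd : gaussianArea n p (2 * t) S ≤ Λ) :
    Tendsto (fun k => gaussianArea n p t (Ss k)) atTop (𝓝 (gaussianArea n p t S)) := by
  set N := gaussianNormalization n t with hN
  have hNt : N ≠ ∞ := gaussianNormalization_ne_top n t
  -- the error terms `δ j = 2^{n/2} e^{-Rⱼ²/8t} Λ → 0`
  set δ : ℕ → ℝ≥0∞ := fun j =>
    ENNReal.ofReal ((2 : ℝ) ^ ((n : ℝ) / 2) * Real.exp (-R j ^ 2 / (8 * t))) * Λ with hδ
  have hδlim : Tendsto δ atTop (𝓝 0) := by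
    have h := ENNReal.Tendsto.mul_const (tendsto_errFactor_atTop n ht hR) (Or.inr hΛ)
    rwa [zero_mul] at h
  -- cutoff integrals: `L j X = N * ∫_X w ψⱼ`
  set L : ℕ → Set F → ℝ≥0∞ := fun j X =>
    N * ∫⁻ x in X, gaussianWeight p t x * ψ j x ∂(μHE[n] : Measure F) with hL
  have hlocL : ∀ j, Tendsto (fun k => L j (Ss k)) atTop (𝓝 (L j S)) := fun j =>
    ENNReal.Tendsto.const_mul (hloc j) (Or.inr hNt)
  -- `F(X) ≤ L j X + δ j` and `L j X ≤ F(X)` for `X = S` and `X = Ss k`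
  have hupper : ∀ j (X : Set F), MeasurableSet X → gaussianArea n p (2 * t) X ≤ Λ →
      gaussianArea n p t X ≤ L j X + δ j := by
    intro j X hX hXΛ
    rw [gaussianArea_eq]
    calc N * ∫⁻ x in X, gaussianWeight p t x ∂(μHE[n] : Measure F)
        ≤ N * (∫⁻ x in X, gaussianWeight p t x * ψ j x ∂(μHE[n] : Measure F) +
            ∫⁻ x in X \ ball p (R j), gaussianWeight p t x ∂(μHE[n] : Measure F)) :=
          mul_le_mul' le_rfl (setLIntegral_gaussianWeight_le_cutoff_add n p t X (hψR j))
      _ = L j X + gaussianArea n p t (X \ ball p (R j)) := by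
          rw [mul_add, gaussianArea_eq]
      _ ≤ L j X + δ j := add_le_add le_rfl
          ((gaussianArea_diff_ball_le n p ht hX (hR0 j)).trans (mul_le_mul' le_rfl hXΛ))
  have hlower : ∀ j (X : Set F), L j X ≤ gaussianArea n p t X := by
    intro j X
    rw [gaussianArea_eq]
    refine mul_le_mul' le_rfl (lintegral_mono fun x => ?_)
    calc gaussianWeight p t x * ψ j x ≤ gaussianWeight p t x * 1 :=
          mul_le_mul' le_rfl (hψ1 j x)
      _ = gaussianWeight p t x := mul_one _
  have hbδ : ∀ b : ℝ≥0∞, Tendsto (fun j => b + δ j) atTop (𝓝 b) := fun b => by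
    simpa using (tendsto_const_nhds (x := b)).add hδlim
  refine tendsto_of_le_liminf_of_limsup_le ?_ ?_
  · refine ge_of_tendsto' (hbδ _) fun j => ?_
    calc gaussianArea n p t S ≤ L j S + δ j := hupper j S hS hbd
      _ = liminf (fun k => L j (Ss k)) atTop + δ j := by rw [(hlocL j).liminf_eq]
      _ ≤ liminf (fun k => gaussianArea n p t (Ss k)) atTop + δ j :=
          add_le_add (liminf_le_liminf (Eventually.of_forall fun k => hlower j (Ss k))) le_rfl
  · refine ge_of_tendsto' (hbδ _) fun j => ?_
    calc limsup (fun k => gaussianArea n p t (Ss k)) atTop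
        ≤ limsup (fun k => L j (Ss k) + δ j) atTop :=
          limsup_le_limsup (Eventually.of_forall fun k => hupper j (Ss k) (hSs k) (hbds k))
      _ = L j S + δ j := ((hlocL j).add tendsto_const_nhds).limsup_eq
      _ ≤ gaussianArea n p t S + δ j := add_le_add (hlower j S) le_rfl

end Literature.Geometry.Riemannian
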